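import Summits.CriticalPhenomena.PercolationContinuityZ3.Theorems.SahiMasterFamilyCommonPivotal
import Literature.Computability.AlgebraicComplexity.SetMultilinear

/-!
# Expectations under the product weight as polynomials in the parameters; Möbius coefficients

Infrastructure for `SahiMasterFamilyTopCoeff.lean` (crux `NoHeavyLowerTail`, stmt-CriticalPhenomena-4575; unit
`prim-master-conj`): the expectation `E_p(h) = Σ_ω h(ω) μ_p(ω)` of a real function `h` on configurations
`ω ⊆ ι` under the product weight, as an honest POLYNOMIAL in the parameters `(X_e)_{e ∈ ι}`:

* `polyWeight ω = ∏_e (X_e if e ∈ ω else 1 − X_e)`, `exPoly h = Σ_ω h(ω)·polyWeight ω ∈ ℝ[X]`, evaluating to the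
  tree's `weight x` / `ex (weight x) h` (`eval_polyWeight`, `eval_exPoly`; `bernoulliWeight p = weight (p ·)`);
* the Möbius expansion `exPoly h = Σ_T ĉ_T(h) X^T` (`exPoly_eq_sum_mobCoeff`) in squarefree monomials
  `X^T = monomial (blockProfile T) 1` (`blockProfile T = Σ_{e ∈ T} single e 1` of `Literature…SetMultilinear`), with `ĉ_T(h) = Σ_{ω ⊆ T} (−1)^{|T∖ω|} h(ω)` (`mobCoeff`, `coeff_blockProfile_exPoly`);
* if `h` is determined by the coordinates in `S`, then `ĉ_T(h) = 0` for `T ⊄ S` (`mobCoeff_eq_zero_of_not_subset`),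
  so every monomial of `exPoly h` is `≤ X^S` (`le_blockProfile_of_mem_support_exPoly`); `exPoly h` has degree `≤ 1` in
  each variable;
* coefficient bookkeeping for products of polynomials with bounded supports (`coeff_add_mul_of_support_le`: the
  coefficient of `X^{a+b}` in `PQ` is the product of the top coefficients; `coeff_mul_eq_zero_of_not_le`).
Everything here is proved; axioms standard. [this work]
-/

noncomputable section

open scoped Classical

namespace Summit.CriticalPhenomena.PercolationContinuityZ3.Theorems

open Finset Function MvPolynomial
open Literature.Computability.AlgebraicComplexity (blockProfile blockProfile_apply blockProfile_injective)
open Literature.Combinatorics.Sahi2008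
open Literature.Probability.Percolation (DeterminedBy determinedBy_iff)
open Literature.Probability.Percolation.BHK2006 (weight)
open Literature.Probability.Percolation.DecisionTree (ind ind_of_mem ind_of_not_mem ind_nonneg)

section Poly

variable {ι : Type*} [Fintype ι]

/-! ### Expectations under the product weight as polynomials in the parameters -/

/-- The universal product weight `W(ω) = ∏_e (X_e if e ∈ ω else 1 − X_e) ∈ ℝ[X]`. [this work] -/
def polyWeight (ω : Set ι) : MvPolynomial ι ℝ := ∏ e, (if e ∈ ω then X e else 1 - X e)

/-- `W(ω)` evaluates to the product weight. [this work] -/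
theorem eval_polyWeight (x : ι → ℝ) (ω : Set ι) : eval x (polyWeight ω) = weight x ω := by
  simp only [polyWeight, eval_prod, weight]
  refine prod_congr rfl fun e _ => ?_
  split_ifs <;> simp

/-- The expectation polynomial `E(h) = Σ_ω h(ω) W(ω) ∈ ℝ[X]` of `h : Set ι → ℝ`. [this work] -/
def exPoly (h : Set ι → ℝ) : MvPolynomial ι ℝ := ∑ ω, C (h ω) * polyWeight ω

/-- `E(h)` evaluates to the expectation under the product weight. [this work] -/
theorem eval_exPoly (x : ι → ℝ) (h : Set ι → ℝ) : eval x (exPoly h) = ex (weight x) h := by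
  simp only [exPoly, eval_sum, map_mul, eval_C, eval_polyWeight, ex]
  exact sum_congr rfl fun ω _ => mul_comm _ _

omit [Fintype ι] in
/-- Squarefree exponents `X^T = monomial (blockProfile T) 1` (`blockProfile T = Σ_{e∈T} single e 1`, reused from
`Literature.Computability.AlgebraicComplexity`): `X^T ≤ X^S` iff `T ⊆ S`. [folklore] -/
theorem blockProfile_le_iff {T S : Finset ι} : blockProfile T ≤ blockProfile S ↔ T ⊆ S := by
  constructor
  · intro h e he
    have := h e
    rw [blockProfile_apply, blockProfile_apply, if_pos he] at this
    by_contra hS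
    rw [if_neg hS] at this
    exact Nat.not_succ_le_zero 0 this
  · intro h e
    rw [blockProfile_apply, blockProfile_apply]
    by_cases he : e ∈ T
    · rw [if_pos he, if_pos (h he)]
    · rw [if_neg he]; exact Nat.zero_le _

/-- The Möbius sign `(−1)^{|T ∖ ω|} = ∏_{e ∈ T} (1 if e ∈ ω else −1)`. [folklore] -/
def moebSign (T : Finset ι) (ω : Set ι) : ℝ := ∏ e ∈ T, (if e ∈ ω then (1 : ℝ) else -1)

/-- **Möbius (top) coefficient** of `h` on the finite set `T`: `ĉ_T(h) = Σ_{ω ⊆ T} (−1)^{|T∖ω|} h(ω)` — the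
coefficient of the squarefree monomial `X^T` in `E(h)` (`coeff_blockProfile_exPoly`).  For the indicator of an up-set
determined by `T` this is `±` the reduced Euler characteristic of the simplicial complex of non-members. [this work] -/
def mobCoeff (h : Set ι → ℝ) (T : Finset ι) : ℝ := ∑ ω : Set ι, if ω ⊆ ↑T then moebSign T ω * h ω else 0

/-- Expansion of the universal weight of one configuration in squarefree monomials:
`W(ω) = Σ_{T ⊇ ω} (−1)^{|T∖ω|} X^T`. [this work] -/
theorem polyWeight_eq_sum (ω : Set ι) :
    polyWeight ω = ∑ T : Finset ι, C (if ω ⊆ ↑T then moebSign T ω else 0) * monomial (blockProfile T) 1 := by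
  have hfac : ∀ e : ι, (if e ∈ ω then X e else 1 - X e : MvPolynomial ι ℝ) =
      C (if e ∈ ω then (1 : ℝ) else -1) * X e + C (if e ∈ ω then (0 : ℝ) else 1) := by
    intro e; split_ifs <;> simp; ring
  simp only [polyWeight, hfac]
  rw [prod_add, powerset_univ]
  refine sum_congr rfl fun T _ => ?_
  rw [prod_mul_distrib, ← map_prod, ← map_prod]
  have hX : ∏ e ∈ T, (X e : MvPolynomial ι ℝ) = monomial (blockProfile T) 1 := by
    rw [blockProfile, monomial_sum_one]; rfl
  rw [hX]
  have h0 : (∏ e ∈ univ \ T, (if e ∈ ω then (0 : ℝ) else 1)) = if ω ⊆ ↑T then 1 else 0 := by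
    have : (fun e : ι => (if e ∈ ω then (0 : ℝ) else 1)) = fun e => if e ∉ ω then 1 else 0 := by
      funext e; split_ifs <;> simp_all
    rw [this, prod_boole]
    congr 1
    refine propext ⟨fun h a ha => ?_, fun h e he => ?_⟩
    · by_contra haT
      exact h a (mem_sdiff.2 ⟨mem_univ a, haT⟩) ha
    · exact fun heω => (mem_sdiff.1 he).2 (h heω)
  rw [h0, moebSign]
  split_ifs <;> simp [mul_comm]

/-- **Möbius expansion of the expectation polynomial**: `E(h) = Σ_T ĉ_T(h) X^T`. [this work] -/
theorem exPoly_eq_sum_mobCoeff (h : Set ι → ℝ) :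
    exPoly h = ∑ T : Finset ι, C (mobCoeff h T) * monomial (blockProfile T) 1 := by
  simp only [exPoly, polyWeight_eq_sum, mul_sum]
  rw [sum_comm]
  refine sum_congr rfl fun T _ => ?_
  simp only [mobCoeff, map_sum, sum_mul]
  refine sum_congr rfl fun ω _ => ?_
  rw [← mul_assoc, ← map_mul]
  congr 2
  split_ifs <;> ring

/-- The coefficient of the squarefree monomial `X^T` in `E(h)` is the Möbius coefficient `ĉ_T(h)`. [this work] -/
theorem coeff_blockProfile_exPoly (h : Set ι → ℝ) (T : Finset ι) :
    coeff (blockProfile T) (exPoly h) = mobCoeff h T := by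
  rw [exPoly_eq_sum_mobCoeff, coeff_sum]
  simp only [coeff_C_mul, coeff_monomial]
  rw [sum_eq_single T]
  · simp
  · intro T' _ hT'
    rw [if_neg fun hEq => hT' (blockProfile_injective hEq), mul_zero]
  · intro hT; exact absurd (mem_univ T) hT

/-- Every monomial of `E(h)` is squarefree: `m = X^T` with `ĉ_T(h) ≠ 0`. [this work] -/
theorem exists_of_mem_support_exPoly {h : Set ι → ℝ} {m : ι →₀ ℕ} (hm : m ∈ (exPoly h).support) :
    ∃ T : Finset ι, m = blockProfile T ∧ mobCoeff h T ≠ 0 := by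
  rw [mem_support_iff, exPoly_eq_sum_mobCoeff, coeff_sum] at hm
  obtain ⟨T, _, hT⟩ := exists_ne_zero_of_sum_ne_zero hm
  simp only [coeff_C_mul, coeff_monomial] at hT
  by_cases hEq : blockProfile T = m
  · rw [if_pos hEq, mul_one] at hT
    exact ⟨T, hEq.symm, hT⟩
  · rw [if_neg hEq, mul_zero] at hT
    exact absurd rfl hT

/-- `E(h)` has degree `≤ 1` in every variable. [this work] -/
theorem degreeOf_exPoly_le (h : Set ι → ℝ) (e : ι) : degreeOf e (exPoly h) ≤ 1 := by
  rw [degreeOf_le_iff]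
  intro m hm
  obtain ⟨T, rfl, -⟩ := exists_of_mem_support_exPoly hm
  rw [blockProfile_apply]
  split_ifs <;> simp

omit [Fintype ι] in
/-- The indicator of an event determined by `S` is determined by `S` (as a real function: configurations agreeing
on `S` have the same value). [folklore] -/
theorem ind_determinedBy {A : Set (Set ι)} {S : Finset ι} (hA : DeterminedBy A (↑S : Set ι)) :
    ∀ ω ω' : Set ι, ω ∩ ↑S = ω' ∩ ↑S → ind A ω = ind A ω' := by
  intro ω ω' hωω'
  have key := (determinedBy_iff A ↑S).1 hA ω ω' hωω'
  by_cases hω : ω ∈ A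
  · rw [ind_of_mem hω, ind_of_mem (key.1 hω)]
  · rw [ind_of_not_mem hω, ind_of_not_mem fun h' => hω (key.2 h')]

omit [Fintype ι] in
/-- Flipping one coordinate of `T` flips the Möbius sign. [folklore] -/
theorem moebSign_symmDiff {T : Finset ι} {e : ι} (he : e ∈ T) (ω : Set ι) :
    moebSign T (symmDiff ω {e}) = -moebSign T ω := by
  simp only [moebSign]
  rw [← mul_prod_erase T _ he, ← mul_prod_erase T _ he]
  have h1 : (if e ∈ symmDiff ω {e} then (1 : ℝ) else -1) = -(if e ∈ ω then (1 : ℝ) else -1) := by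
    by_cases heω : e ∈ ω
    · have : e ∉ symmDiff ω {e} := by simp [Set.mem_symmDiff, heω]
      rw [if_neg this, if_pos heω]
    · have : e ∈ symmDiff ω {e} := by simp [Set.mem_symmDiff, heω]
      rw [if_pos this, if_neg heω, neg_neg]
  rw [h1, neg_mul]
  congr 2
  refine prod_congr rfl fun i hi => ?_
  have hie : i ≠ e := ne_of_mem_erase hi
  have : (i ∈ symmDiff ω {e}) ↔ i ∈ ω := by simp [Set.mem_symmDiff, hie]
  simp only [this]

/-- **Möbius coefficients off the determining set vanish**: if `h` is determined by `S` and `T ⊄ S` then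
`ĉ_T(h) = 0` (pair `ω` with `ω △ {e}`, `e ∈ T ∖ S`). [this work] -/
theorem mobCoeff_eq_zero_of_not_subset {h : Set ι → ℝ} {S T : Finset ι}
    (hS : ∀ ω ω' : Set ι, ω ∩ ↑S = ω' ∩ ↑S → h ω = h ω') (hT : ¬ T ⊆ S) : mobCoeff h T = 0 := by
  obtain ⟨e, heT, heS⟩ := not_subset.1 hT
  unfold mobCoeff
  refine sum_involution (fun ω _ => symmDiff ω {e}) ?_ ?_ ?_ ?_
  · intro ω _
    have hsub : (symmDiff ω {e} ⊆ ↑T) ↔ ω ⊆ ↑T := by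
      constructor
      · intro hω i hi
        by_cases hie : i = e
        · subst hie; exact heT
        · exact hω (by simp [Set.mem_symmDiff, hi, hie])
      · intro hω i hi
        rcases (Set.mem_symmDiff).1 hi with ⟨hiω, -⟩ | ⟨hie, -⟩
        · exact hω hiω
        · rw [Set.mem_singleton_iff.1 hie]; exact heT
    have hh : h (symmDiff ω {e}) = h ω := by
      refine hS _ _ ?_
      ext i
      simp only [Set.mem_inter_iff, Set.mem_symmDiff, Set.mem_singleton_iff, mem_coe]
      constructor
      · rintro ⟨h1 | h2, hiS⟩
        · exact ⟨h1.1, hiS⟩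
        · exact absurd (h2.1 ▸ hiS) heS
      · rintro ⟨hiω, hiS⟩
        exact ⟨Or.inl ⟨hiω, fun hie => heS (hie ▸ hiS)⟩, hiS⟩
    simp only [hsub, hh, moebSign_symmDiff heT]
    split_ifs <;> ring
  · intro ω _ hne hEq
    have : e ∈ symmDiff ω {e} ↔ e ∈ ω := by rw [hEq]
    simp [Set.mem_symmDiff] at this
  · intro ω _; exact mem_univ _
  · intro ω _
    ext i
    simp only [Set.mem_symmDiff, Set.mem_singleton_iff]
    tauto

/-- If `h` is determined by `S`, every monomial of `E(h)` is `X^T` with `T ⊆ S`; in particular it is `≤ X^S`.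
[this work] -/
theorem le_blockProfile_of_mem_support_exPoly {h : Set ι → ℝ} {S : Finset ι}
    (hS : ∀ ω ω' : Set ι, ω ∩ ↑S = ω' ∩ ↑S → h ω = h ω') {m : ι →₀ ℕ} (hm : m ∈ (exPoly h).support) :
    m ≤ blockProfile S := by
  obtain ⟨T, rfl, hT⟩ := exists_of_mem_support_exPoly hm
  rw [blockProfile_le_iff]
  by_contra hTS
  exact hT (mobCoeff_eq_zero_of_not_subset hS hTS)

/-- Every monomial of `E(h)` is `≤ X^{univ}` (squarefree). [this work] -/
theorem le_blockProfile_univ_of_mem_support_exPoly {h : Set ι → ℝ} {m : ι →₀ ℕ}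
    (hm : m ∈ (exPoly h).support) : m ≤ blockProfile univ := by
  obtain ⟨T, rfl, -⟩ := exists_of_mem_support_exPoly hm
  exact blockProfile_le_iff.2 (subset_univ T)

/-! ### Coefficients of products of polynomials with bounded supports -/

omit [Fintype ι] in
/-- If the monomials of `P` are `≤ a` and those of `Q` are `≤ b`, the coefficient of `X^{a+b}` in `PQ` is the product
of the two top coefficients. [folklore] -/
theorem coeff_add_mul_of_support_le {P Q : MvPolynomial ι ℝ} {a b : ι →₀ ℕ}
    (hP : ∀ m ∈ P.support, m ≤ a) (hQ : ∀ m ∈ Q.support, m ≤ b) :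
    coeff (a + b) (P * Q) = coeff a P * coeff b Q := by
  rw [coeff_mul]
  have key : ∀ xy ∈ antidiagonal (a + b), xy ≠ (a, b) → coeff xy.1 P * coeff xy.2 Q = 0 := by
    rintro ⟨x, y⟩ hxy hne
    rw [Finset.HasAntidiagonal.mem_antidiagonal] at hxy
    by_cases hx : x ∈ P.support
    · by_cases hy : y ∈ Q.support
      · exfalso
        apply hne
        have hxa := hP x hx
        have hyb := hQ y hy
        have hsum : ∀ e, x e + y e = a e + b e := fun e => by
          have h1 := congrArg (fun m : ι →₀ ℕ => m e) hxy
          simpa only [Finsupp.add_apply] using h1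
        have hx' : x = a := le_antisymm hxa fun e => by have := hsum e; have := hyb e; omega
        have hy' : y = b := le_antisymm hyb fun e => by have := hsum e; have := hxa e; omega
        rw [hx', hy']
      · rw [notMem_support_iff.1 hy, mul_zero]
    · rw [notMem_support_iff.1 hx, zero_mul]
  exact sum_eq_single_of_mem (a, b) (Finset.HasAntidiagonal.mem_antidiagonal.2 (by rfl)) key

omit [Fintype ι] in
/-- If the monomials of `P` are `≤ a` and those of `Q` are `≤ b`, every monomial of `PQ` is `≤ a + b`:
coefficients beyond vanish. [folklore] -/
theorem coeff_mul_eq_zero_of_not_le {P Q : MvPolynomial ι ℝ} {a b c : ι →₀ ℕ}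
    (hP : ∀ m ∈ P.support, m ≤ a) (hQ : ∀ m ∈ Q.support, m ≤ b) (hc : ¬ c ≤ a + b) :
    coeff c (P * Q) = 0 := by
  rw [coeff_mul]
  refine sum_eq_zero ?_
  rintro ⟨x, y⟩ hxy
  rw [Finset.HasAntidiagonal.mem_antidiagonal] at hxy
  by_cases hx : x ∈ P.support
  · by_cases hy : y ∈ Q.support
    · exfalso
      exact hc (hxy ▸ add_le_add (hP x hx) (hQ y hy))
    · rw [notMem_support_iff.1 hy, mul_zero]
  · rw [notMem_support_iff.1 hx, zero_mul]

omit [Fintype ι] in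
/-- Support of a product: monomials of `PQ` are `≤ a + b`. [folklore] -/
theorem support_mul_le {P Q : MvPolynomial ι ℝ} {a b : ι →₀ ℕ}
    (hP : ∀ m ∈ P.support, m ≤ a) (hQ : ∀ m ∈ Q.support, m ≤ b) :
    ∀ m ∈ (P * Q).support, m ≤ a + b := by
  intro m hm
  by_contra hc
  exact (mem_support_iff.1 hm) (coeff_mul_eq_zero_of_not_le hP hQ hc)

omit [Fintype ι] in
/-- A coefficient beyond the support bound vanishes. [folklore] -/
theorem coeff_eq_zero_of_not_le {P : MvPolynomial ι ℝ} {a c : ι →₀ ℕ} (hP : ∀ m ∈ P.support, m ≤ a)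
    (hc : ¬ c ≤ a) : coeff c P = 0 := by
  by_contra h
  exact hc (hP c (mem_support_iff.2 h))

end Poly

end Summit.CriticalPhenomena.PercolationContinuityZ3.Theorems
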